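import Literature.NumberTheory.EllipticCurves.PAdicOneVariableSupportOfColemanTraceTwo
import Literature.NumberTheory.GaloisRepresentations.LubinTateComparisonTraceTransportRelTwo
import HarnessLib

/-!
# `p = 2`, relative coefficients: `𝒮_E G = 0` over `𝒪_E` ⟹ the measure of `θ(G ∘ ϑ)` is supported on `ℤ₂^×`,
# with the socket `∫ x^{k+1} d(restrictUnits (x⁻¹·D)) = [S^0] D^k`

Topic `NumberTheory/EllipticCurves`; namespace `Literature.NumberTheory.EllipticCurves`.

The relative-coefficient twin of `PAdicOneVariableSupportOfColemanTraceTwo.lean` (de Shalit 1987, I.3.3 (7) ⟺ (7′),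
I.3.5 (11), run over the unramified base `k'` as in I.3.8 / III.1.3): Coleman's trace operator `𝒮_E` with
coefficients in `𝒪_E` (`relTraceTwo`, tree `LubinTateColemanRelativeTraceTwo.lean`), the relative seam
`sum_nthRootsFinset_tsum_eq_zero_of_relTraceTwo_eq_zero` (`LubinTateComparisonTraceTransportRelTwo.lean`), the
transfer along `θ : ℂ_F → ℂ_2` and the `ℂ_2` support criterion / socket:

* ★★★ `invAmice₁_μ_eq_zero_of_relTraceTwo_eq_zero` — `𝒮_E G = 0` (`G ∈ 𝒪_E⟦X⟧`) ⟹ `D_{θ(G∘ϑ)}` vanishes on every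
  non-unit class of `ℤ/2^{N+1}`;
* ★★★ `integral_restrictUnits_density_unitInv_pow_succ_of_relTraceTwo_eq_zero` — the socket
  `∫ x^{k+1} d(restrictUnits (x⁻¹ · D_{θ(G∘ϑ)})) = [S^0] D^k (θ(G∘ϑ))` for every `k`.

Everything is proved; no named facts, no definitions, no instances, no `sorry`.

## References

* [deShalit1987] E. de Shalit, *Iwasawa theory of elliptic curves with complex multiplication* (1987),
  I.3.3 (7)–(8) (p. 17–18), I.3.5 (11) (p. 18), I.3.8.
-/

noncomputable section

open MvPowerSeries Filter
open scoped PowerSeries.WithPiTopology Topology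

namespace Literature.NumberTheory.EllipticCurves

section SupportOfColemanTraceRelTwo

open ValuativeRel IsLocalRing Field
open Literature.NumberTheory.GaloisRepresentations Literature.NumberTheory.GaloisRepresentations.IsNonarchimedeanLocalField
  Literature.NumberTheory.GaloisRepresentations.LubinTate Literature.NumberTheory.PAdicHodge

variable {F : Type} [Field F] [ValuativeRel F] [TopologicalSpace F] [IsNonarchimedeanLocalField F]

attribute [local instance] ltNormUniformSpace ltNormIsUniformAddGroup rk1 nF nE fintypeResidueField

variable (hq : residueFieldCard F = 2) (h2 : (valuation F).IsUniformizer (((2 : ℕ) : 𝒪[F]) : F))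
  {σ₀ : absoluteGaloisGroup F} (hσ₀ : IsAbsArithFrob σ₀) (u : 𝒪[F]ˣ)
  {ε : (maxUnramifiedCompletion F)ˣ}
  (hε : maxUnramifiedCompletion.galAut F σ₀ (ε : maxUnramifiedCompletion F) =
    algebraMap 𝒪[F] (maxUnramifiedCompletion F) (u : 𝒪[F]) * (ε : maxUnramifiedCompletion F))
variable (θ : CompletedAlgClosure F →+* ℂ_[2]) (hθc : Continuous θ)
  (hθ1 : ∀ z : CBall F, ‖θ (z : CompletedAlgClosure F)‖ ≤ 1)
  (hθζ : ∀ ζ' : ℂ_[2], (∃ n : ℕ, ζ' ^ 2 ^ n = 1) →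
    ∃ ζ : CompletedAlgClosure F, (∃ n : ℕ, ζ ^ 2 ^ n = 1) ∧ θ ζ = ζ')
variable (E : IntermediateField F (AlgebraicClosure F)) [FiniteDimensional F E]

include hq hθc hθζ in
/-- ★★★ **Relative coefficients**: `𝒮_E G = 0` (`G ∈ 𝒪_E⟦X⟧`) ⟹ `D_{θ(G∘ϑ)}` vanishes on every non-unit class.
[cite: deShalit1987, I.3.3 (7)–(7′) (p. 17), I.3.8] -/
theorem invAmice₁_μ_eq_zero_of_relTraceTwo_eq_zero (G : PowerSeries (unitBall E))
    (hS : relTraceTwo (isUniformizer_unit_mul h2 u) E hq G = 0) (N : ℕ) (b : ZMod (2 ^ (N + 1)))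
    (hb : ¬IsUnit b) :
    (invAmice₁ 2 ((PowerSeries.subst ((compSeriesC h2 hσ₀ u hε).map (algebraMap (UnrCoeff F) (CBall F)))
        (G.map (unitBallToCBall E))).map (θ.comp (CBall F).subtype))
        (norm_coeff_map_le_one θ hθ1
          (PowerSeries.subst ((compSeriesC h2 hσ₀ u hε).map (algebraMap (UnrCoeff F) (CBall F)))
        (G.map (unitBallToCBall E))))).μ (N + 1) b = 0 :=
  PadicComplex.forall_invAmice₁_μ_eq_zero_of_nthRoots (norm_coeff_map_le_one θ hθ1 _)
    (sum_nthRootsFinset_tsum_map_eq_zero_of_forall h2 θ hθc hθζ _ fun _ _ hζ ↦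
      sum_nthRootsFinset_tsum_eq_zero_of_relTraceTwo_eq_zero hq h2 hσ₀ u hε E G hS hζ) N b hb

include hq hθc hθζ in
/-- ★★★ **THE SOCKET from `𝒮_E G = 0`, relative coefficients**: for `H' := θ(G ∘ ϑ)` and every `k`,
`∫ x^{k+1} d(restrictUnits (x⁻¹ · D_{H'})) = [S^0] D^k H'`. [cite: deShalit1987, I.3.5 (11) (p. 18), I.3.8] -/
theorem integral_restrictUnits_density_unitInv_pow_succ_of_relTraceTwo_eq_zero (G : PowerSeries (unitBall E))
    (hS : relTraceTwo (isUniformizer_unit_mul h2 u) E hq G = 0) (k : ℕ) :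
    (restrictUnits ((invAmice₁ 2
        ((PowerSeries.subst ((compSeriesC h2 hσ₀ u hε).map (algebraMap (UnrCoeff F) (CBall F)))
          (G.map (unitBallToCBall E))).map (θ.comp (CBall F).subtype))
        (norm_coeff_map_le_one θ hθ1
          (PowerSeries.subst ((compSeriesC h2 hσ₀ u hε).map (algebraMap (UnrCoeff F) (CBall F)))
        (G.map (unitBallToCBall E))))).density (ProfiniteTower.padicInt_isUniform 2) (unitInv ℂ_[2])
        uniformContinuous_unitInv norm_unitInv_le)).integral (fun x ↦ padicIntCast ℂ_[2] (x ^ (k + 1))) =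
      PowerSeries.constantCoeff (mahlerD^[k]
        ((PowerSeries.subst ((compSeriesC h2 hσ₀ u hε).map (algebraMap (UnrCoeff F) (CBall F)))
          (G.map (unitBallToCBall E))).map (θ.comp (CBall F).subtype))) :=
  PadicComplex.integral_restrictUnits_density_unitInv_pow_succ_eq_constantCoeff (norm_coeff_map_le_one θ hθ1 _)
    (sum_nthRootsFinset_tsum_map_eq_zero_of_forall h2 θ hθc hθζ _ fun _ _ hζ ↦
      sum_nthRootsFinset_tsum_eq_zero_of_relTraceTwo_eq_zero hq h2 hσ₀ u hε E G hS hζ) k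


end SupportOfColemanTraceRelTwo

end Literature.NumberTheory.EllipticCurves

end
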